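/-
Copyright (c) 2026 the pub-hodgecm-mathlib formalisation cell (harness21).  Typer seat hodgecm-mathlib-typ-T5a (g0), topic T5 = P8
«(C♯)hol interior», 2026-08-31.  KERNEL module: THEOREMS ONLY (no definition, no named fact, no `sorry`).
-/
import Literature.NumberTheory.Automorphic.Liu2021.ThetaLiftFromLineArchTypes
import Literature.NumberTheory.Automorphic.Liu2021.ThetaLiftFromLineArchAdmissible
import HarnessLib

/-!
# [Liu2021, proof of Prop. 4.13 Case 1, l. 2141 «By Lemma D.2, we know that `μ` is of weight one and `ε_e` is `μ`-admissible»] — the CM-TYPE ARITHMETIC: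
# the raw archimedean table (C∞, Cc) implies node C = D2 of the (C♯)hol interior (PROVED; node C retires to C∞ + Cc)

Topic `NumberTheory/Automorphic/Liu2021`; namespace `Literature.NumberTheory.Automorphic.Liu2021`.  THEOREMS ONLY, proved from the definitions:
★ `IsConjugateSymplectic.infinityType ∕ cmType` (`cmType = cmTypeOf infinityType = {φ ∣ exponentAt infinityType φ < 0}`, ★ `ConjugateSelfDualCharacters`),
★ `HasWeight` (`∃ e, HasInfinityType ∧ weight e = 𝔴`), ★ `IsAdmissibleElement` (`e ≠ 0 ∧ ē = −e ∧ ∀ τ′ ∈ Φ, Im τ′(e) < 0`), ★ `exponentAt_conjugate`,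
★ `natAbs_exponentAt`, ★ `complexConj_imagUnit`, Mathlib `InfinitePlace.mk_eq_iff`, `IsCMField.complexConj_apply_eq_self`.

* `hasWeightOne_admissible_of_archTypes` — **C∞ → Cc → C**: the two applied clauses of [Liu2021, Lem. D.2] in raw-table form
  (★ `meetsThetaLiftFromLine_hol_archTypeAt`, ★ `meetsThetaLiftFromLine_hol_archTypeAway`, p826262) imply ★ `meetsThetaLiftFromLine_hol_hasWeightOne_admissible`
  (p826167).  This is exactly Liu's sentence l. 2141 unfolded ([Liu2021, §4.1 l. 1908–1912, Rem. 4.4, Def. 4.3, Def. 4.12]): `|m_w| = 1` at every place (weight one);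
  `Φ_μ = {τ′ ∣ exponentAt τ′ < 0}` picks, over each place, the embedding with `m = −1`, at which the table says `Im τ′(e) < 0` (admissible); `e = a·δ′ ≠ 0` and
  `ē = −e` because `a ∈ L⁺` and `δ̄′ = −δ′`.
So the T5 line may register the stubs {D1, B, C∞, Cc, F} instead of {D1, B, C, F}: node C is no longer a letter once C∞ and Cc are.
HC_CM is proved only modulo the printed citations until rung 0 closes; this file discharges nothing by itself (it re-routes one booked statement to two).

## References
* [Liu2021] Y. Liu, Camb. J. Math. 9 (2021) = arXiv:2102.11518: proof of Prop. 4.13 Case 1 (l. 2137–2141, p. 48); §4.1 (l. 1908–1912), Rem. 4.4, Def. 4.3,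
  Def. 4.12 (p. 47); App. D Lem. D.2 (p. 127).
-/

noncomputable section

open NumberField NumberField.InfinitePlace MeasureTheory IsDedekindDomain
open scoped Matrix ComplexOrder

namespace Literature.NumberTheory.Automorphic.Liu2021

open _root_.MeasureTheory
open Literature.NumberTheory.Automorphic Literature.NumberTheory.Automorphic.UnitaryGroup
open Literature.NumberTheory.Automorphic.UnitaryGroup.CotangentForms
open Literature.NumberTheory.Automorphic.IdeleClassGroup
open Literature.NumberTheory.GelbartRogawski1991.UnitaryDualPair
open Literature.AlgebraicGeometry.Liu2021 (IsAdmissibleElement)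

/-- **The lane's discriminant `e = a·δ′` is a non-zero purely imaginary element**: `a·(2·imagUnit L)⁻¹ ≠ 0` and
`\overline{a·(2·imagUnit L)⁻¹} = −a·(2·imagUnit L)⁻¹` for `a ∈ (L⁺)ˣ` ([Liu2021, App. D §D.1 Step 1]: `ε ∈ E^{−×}`). [cite: Liu2021, App. D §D.1 Step 1 (l. 5217); Def. 4.12 p. 47] -/
theorem lineDisc_ne_zero_and_skew (L : Type) [Field L] [NumberField L] [IsCMField L] (a : (↥(maximalRealSubfield L))ˣ) :
    algebraMap (↥(maximalRealSubfield L)) L a * (2 * imagUnit L)⁻¹ ≠ 0 ∧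
      IsCMField.complexConj L (algebraMap (↥(maximalRealSubfield L)) L a * (2 * imagUnit L)⁻¹) =
        -(algebraMap (↥(maximalRealSubfield L)) L a * (2 * imagUnit L)⁻¹) := by
  have h2δ : (2 : L) * imagUnit L ≠ 0 := mul_ne_zero two_ne_zero (imagUnit_ne_zero L)
  refine ⟨mul_ne_zero ((map_ne_zero (algebraMap (↥(maximalRealSubfield L)) L)).2 a.ne_zero) (inv_ne_zero h2δ), ?_⟩
  have ha : IsCMField.complexConj L (algebraMap (↥(maximalRealSubfield L)) L a) = algebraMap (↥(maximalRealSubfield L)) L a :=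
    IsCMField.complexConj_apply_eq_self L (a : ↥(maximalRealSubfield L))
  rw [map_mul, map_inv₀, map_mul, map_ofNat, complexConj_imagUnit, ha, mul_neg, inv_neg, mul_neg]

/-- **C∞ → Cc → C** ([Liu2021, Prop. 4.13 proof Case 1, l. 2141]): the raw archimedean table implies «`μ` is of weight one and `ε_e` is `μ`-admissible»,
i.e. ★ `meetsThetaLiftFromLine_hol_hasWeightOne_admissible`. [cite: Liu2021, Prop. 4.13 proof Case 1 (l. 2141, p. 48); Def. 4.3; Def. 4.12 p. 47; Rem. 4.4] -/
theorem hasWeightOne_admissible_of_archTypes (hAt : meetsThetaLiftFromLine_hol_archTypeAt)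
    (hAway : meetsThetaLiftFromLine_hol_archTypeAway) : meetsThetaLiftFromLine_hol_hasWeightOne_admissible := by
  intro L _ _ _ ι H T hT hdef hd n' e₁ dV hdV hdV0 g hg ιA hιA _ μA _ P μ hμ a hmeet hP
  obtain ⟨hexp, him⟩ := hAt L ι H T hT hdef hd e₁ dV hdV hdV0 g hg ιA hιA μA P μ hμ a hmeet hP
  have haway := hAway L ι H T hT hdef hd e₁ dV hdV hdV0 g hg ιA hιA μA P μ hμ a hmeet hP
  refine ⟨⟨hμ.infinityType, hμ.hasInfinityType_infinityType, ?_⟩, ?_⟩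
  · -- weight one: `|e_w| = 1` at every place
    funext w
    rw [weight_apply, Pi.one_apply]
    by_cases hw : w = InfinitePlace.mk ι
    · rw [hw, ← natAbs_exponentAt hμ.infinityType ι, hexp]; rfl
    · have hφ : InfinitePlace.mk w.embedding ≠ InfinitePlace.mk ι := by rwa [mk_embedding]
      rcases haway w.embedding hφ with ⟨h1, -⟩ | ⟨h1, -⟩
      · rw [← mk_embedding w, ← natAbs_exponentAt hμ.infinityType w.embedding, h1]; rfl
      · rw [← mk_embedding w, ← natAbs_exponentAt hμ.infinityType w.embedding, h1]; rfl
  · -- admissibility for `Φ_μ = {τ′ ∣ exponentAt < 0}`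
    obtain ⟨hne, hskew⟩ := lineDisc_ne_zero_and_skew L a
    refine ⟨hne, hskew, fun τ' hτ' => ?_⟩
    change exponentAt hμ.infinityType τ' < 0 at hτ'
    by_cases hw : InfinitePlace.mk τ' = InfinitePlace.mk ι
    · rcases InfinitePlace.mk_eq_iff.1 hw with h | h
      · rw [h]; exact him
      · -- `τ′ = ῑ`: exponent `+1`, not in `Φ_μ`
        exfalso
        have hτ : τ' = ComplexEmbedding.conjugate ι := by
          rw [← h]; exact ((ComplexEmbedding.involutive_conjugate (K := L)) τ').symm
        have hι : ¬ ComplexEmbedding.IsReal ι :=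
          not_isReal_of_mk_isComplex (IsTotallyComplex.isComplex _)
        rw [hτ, exponentAt_conjugate _ hι, hexp] at hτ'
        norm_num at hτ'
    · rcases haway τ' hw with ⟨-, h2⟩ | ⟨h1, -⟩
      · exact h2
      · rw [h1] at hτ'; norm_num at hτ'

end Literature.NumberTheory.Automorphic.Liu2021

end
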